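import Summits.QuantumFields.BalabanUV.Beta.GAN24.CombFreeGaugeLegCharges
import Summits.QuantumFields.BalabanUV.Beta.GAN24.BorderGaugeLegContact
import Summits.QuantumFields.BalabanUV.Beta.GAN24.BlockWeightContourCommutation
import Literature.MathematicalPhysics.QuantumFieldTheory.Balaban1983to89.Beta.RootedKernelReflection

/-!
# `BalabanUV.Beta.GAN24.GaugeLegDefectsBlockConstant` — binder row G-an2-4 ∕ (CONV-C), the (S) row ∕ (W-γ) one level up, THE SECTOR LAWS:
# **THE BORDER TABLE `vhSAt` AND THE CONSTRAINT-HESSIAN TABLE `hessFFAt` AGAINST A BLOCK-CONSTANT PURE GAUGE `d(ψ ∘ blk)` ON THE FLUCTUATION LEG,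
# CONTRACTED WITH A COMB-FREE 1-FORM, RETURN EXACTLY THE END-INSIDE ∕ BASE-OUTSIDE PARTIAL CONTOUR DEFECTS:**
# `Σ'_u Σ_κ′ g κ′ u·(Σ'_z Σ_α V κ′ u (L•y) z (inr μ)(inl α)·dz Ψ α z) = −(L^{d+1})⁻¹·(dz ψ) μ y·EI_L g μ y`,
# `Σ'_u Σ_κ a κ u·(Σ'_x Σ_κ₂ h^ρ_{(μ,w)} u x (inl κ)(inl κ₂)·dz Ψ κ₂ x) = −(2L^{d+1})⁻¹·(dz ψ) μ w·(BO_L a μ w − EI_L a μ w)`   (`Ψ = ψ ∘ blk L`)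
# (G-an2-4 CRUX TEAM (2), seat `b2b-balaban-gan24-formalise-leaf-06` = the (γ) hand, gen 49, FILE (β))

NOT IN PRINT; OUR BOOKKEEPING ([folklore] BY NAME over leaf-02 g47 `BorderGaugeLegContact.tsum_vhSAt_mul_dz` (the fluctuation-slot pure-gauge law of an1's border table),
leaf-02's `HessianGaugeLegContact.tsum_hessFFAt_mul_dz` + `ContactLambdaCommutator.tsum_sum_mul_gaugeWeight_mul_linKerAt ∕ tsum_sum_mul_linKerAt` (the same for an1's constraint-Hessian
table and the `q¹`-pairing), leaf-06 g47 FILE A `CombFreeGaugeLegCharges.linAvgAt_eq_contourSum_of_comb_zero` (rooted average = straight contour sum on comb-free forms) and TODAY's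
FILE (α) `BlockWeightContourCommutation` (commuting the block-constant weight through the contour sum); 0 `def`, 0 cited fact, 0 `def … : Prop`, 0 sorry).
HONEST FRAMING (cell contract, verbatim): «discharging `BetaPertH` makes Bałaban's UV stability UNCONDITIONAL — a real constructive-QFT result; it is NOT the continuum limit and NOT
the Clay problem.»  HONEST DEPENDENCY (verbatim): «continuum YM on T⁴ ⇐ BetaPertH ∧ nine spine estimates (0/9 proved); BetaPertH ⇐ (D1) ∧ (D4) ∧ CAP+tail; G-an2-4 gates asym,
D1 and NE2/3/4.»

WHY (R1, journal [GAN24LEAF06-G49-R1]; memo `HOME/b2b-balaban-gan24-formalise-leaf-06/g49/E30-E31-CENSUS.md`).  The (γ) source pairing one level up is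
`X_1 = −𝒮_0(H_0 h; H_0 n, H_0 dψ)` with `H_0 dψ = L^{−(d+1)}·d(ψ ∘ blk)` a BLOCK-CONSTANT pure gauge on the fluctuation leg; its three sectors are the Wilson table (FILE A's law), the
border table `vhSAt` (leg pair `(C_0 n, dΨ)`, background `H_0 h`) and the Lagrange sector `SLam·hessFFAt` (legs `(H_0 n, dΨ)`, coarse weights `−lamCoeff(H_0 h) = C_0 h` by
`DataColumnCombRows`).  ENGINE E31 (kit j178383 ∕ j178588; D = 2, 3; generic AND two-level `h`, generic `n`): border sector `= −L^{−2(d+1)}·(C1′)` and Lagrange sector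
`= (2L^{2(d+1)})^{−1}·(C2′)` to 1e-13, where `(C1′) = ⟨dψ⊙EI(H_0 h), C_0 n⟩`, `(C2′) = ⟨C_0 h, dψ⊙(BO − EI)(H_0 n)⟩`; consequently at Bałaban's pins `cE = L^{d+1}`,
`cVH = −L^{2(d+1)}/2`, `cΛ = 2/L^{d+1}` the `(C1′)` terms of the Wilson and border sectors CANCEL and the closed form of `X_1` rests on `(C2′) = 0` alone (✓ D = 2, 3 for two-level
`h`, block-periodic `n`, centred root).  THIS FILE proves the two sector laws PER SLOT as lattice theorems (the engine's statements are these, summed against `C_0 n` resp. `C_0 h`):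
* §1 `blk_zsmul_add_toSite_add` (block label of the far root point of a coarse bond; `blk_zsmul` ∕ `off_zsmul` are an2's `AxialProjector.blk_zsmul` ∕ `RootedKernelReflection.off_zsmul` BY NAME).
* §2 **`border_gaugeLeg_blockConstant`** — for `g` COMB-FREE, every coarse bond `(μ, y)`, every coarse function `ψ`:
  `Σ'_u Σ_κ′ g κ′ u·(Σ'_z Σ_α vhSAt ρ L κ′ u (L•y) z (inr μ)(inl α)·dz (ψ∘blk L) α z) = (L^{d+1})⁻¹·(𝒬_L((ψ∘blk)⁺⊙g) μ y − ψ(y+e_μ)·𝒬_L g μ y) = −(L^{d+1})⁻¹·(dz ψ) μ y·EI_L g μ y`.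
* §3 **`constraintHessian_gaugeLeg_blockConstant`** — for `a` COMB-FREE (no hypothesis on its contour sums), every `(μ, w)`, every coarse `ψ`:
  `Σ'_u Σ_κ a κ u·(Σ'_x Σ_κ₂ hessFFAt ρ L μ w u x (inl κ)(inl κ₂)·dz (ψ∘blk L) κ₂ x) = −(2L^{d+1})⁻¹·(𝒬_L(σ_{ψ∘blk}⊙a) μ w − σ_ψ(μ,w)·𝒬_L a μ w) = −(2L^{d+1})⁻¹·(dz ψ) μ w·(BO_L a μ w − EI_L a μ w)`
  (FILE A's `hessFFAt_gaugeLeg_charge` is the case `𝒬_L a = 0`, `𝒬_L(σ⊙a)` kept whole).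
Asserts NO value of any resolvent column; NOTHING of (W-γ) at levels ≥ 1 ∕ (INV) ∕ (S) discharged; NEVER «G-an2-4 closed» as (CONV-C); NOT D1, NOT `BetaPertH`, NOT continuum, NOT Clay.
2026-08-23; no existing file touched.
-/

noncomputable section

open Finset
open scoped BigOperators
open Literature.MathematicalPhysics.QuantumFieldTheory
open Literature.MathematicalPhysics.QuantumFieldTheory.Balaban1983to89
open Literature.MathematicalPhysics.QuantumFieldTheory.Balaban1983to89.Beta
open ExpKernelCalculus (Site MKer)
open AffineAveraging (Form0 Form1 box toSite unitVec unitVec_apply dz contourSum)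
open AveragingContours (blk blk_block off)
open AxialProjector (blk_zsmul)
open RootedKernelReflection (off_zsmul)
open AveragingContoursRooted (linAvgAt)
open AveragingHessianKernelsRooted (hessFFAt vhSAt linKerAt)
open Summit.QuantumFields.BalabanUV.Beta.AveragingWardRootedStencils (linSymAt linSymAt_inr_inl)
open Summit.QuantumFields.BalabanUV.Beta.AxialDressingRooted (IsCombBondAt)
open Summit.QuantumFields.BalabanUV.Beta.GAN24.CombFreeGaugeLegCharges (linAvgAt_eq_contourSum_of_comb_zero)
open Summit.QuantumFields.BalabanUV.Beta.GAN24.ContactLambdaCommutator (tsum_sum_mul_linKerAt tsum_sum_mul_gaugeWeight_mul_linKerAt)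
open Summit.QuantumFields.BalabanUV.Beta.GAN24.HessianGaugeLegContact (tsum_hessFFAt_mul_dz)
open Summit.QuantumFields.BalabanUV.Beta.GAN24.BorderGaugeLegContact (tsum_vhSAt_mul_dz)
open Summit.QuantumFields.BalabanUV.Beta.GAN24.BlockWeightContourCommutation (contourSum_endWeight_mul contourSum_bondSum_mul)

namespace Summit.QuantumFields.BalabanUV.Beta.GAN24.GaugeLegDefectsBlockConstant

variable {d : ℕ}

/-! ## §1 Block labels of the root points of a coarse bond -/

/-- [folklore] `blk L (L•w + toSite r + L•e_μ) = w + e_μ` for an in-block root offset `r`. -/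
theorem blk_zsmul_add_toSite_add {L : ℕ} (w : Site (d + 1)) {r : Fin (d + 1) → ℕ} (hr : r ∈ box (d + 1) L) (μ : Fin (d + 1)) :
    blk L ((L : ℤ) • w + toSite r + (L : ℤ) • unitVec μ) = w + unitVec μ := by
  have e : (L : ℤ) • w + toSite r + (L : ℤ) • unitVec μ = (L : ℤ) • (w + unitVec μ) + toSite r := by rw [smul_add]; abel
  rw [e, blk_block (w + unitVec μ) hr]

/-! ## §2 The border table against a block-constant pure gauge: the END-INSIDE defect -/

/-- NOT IN PRINT; OUR BOOKKEEPING.  **THE BORDER SECTOR LAW** (box root `ρ = toSite r`, `1 ≤ L`; `g` COMB-FREE; coarse bond `(μ, y)`; any coarse function `ψ`, `Ψ = ψ ∘ blk L`):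
`Σ'_u Σ_κ′ g κ′ u·(Σ'_z Σ_α vhSAt ρ L κ′ u (L•y) z (inr μ)(inl α)·dz Ψ α z) = (L^{d+1})⁻¹·(𝒬_L(Ψ⁺⊙g) μ y − ψ(y + e_μ)·𝒬_L g μ y)`
— leaf-02's fluctuation-slot law gives `(Ψ(u + e_κ′) − ψ(y + e_μ))·q¹,ρ_{(μ,y)}(κ′,u)` per background bond, the `q¹`-pairing of a comb-free form is its straight contour sum. -/
theorem border_gaugeLeg_blockConstant_contour {L : ℕ} (hL : 1 ≤ L) {r : Fin (d + 1) → ℕ} (hr : r ∈ box (d + 1) L) {g : Form1 (d + 1) ℝ}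
    (hg : ∀ κ u, IsCombBondAt (toSite r) L κ u → g κ u = 0) (μ : Fin (d + 1)) (y : Site (d + 1)) (ψ : Site (d + 1) → ℝ) :
    ∑' u, ∑ κ', g κ' u * (∑' z, ∑ α, vhSAt (toSite r) d L rfl κ' u ((L : ℤ) • y) z (Sum.inr μ) (Sum.inl α) * dz (fun x => ψ (blk L x)) α z)
      = ((L : ℝ) ^ (d + 1))⁻¹ * (contourSum L (fun κ' u => ψ (blk L (u + unitVec κ')) * g κ' u) μ y - ψ (y + unitVec μ) * contourSum L g μ y) := by
  -- the fluctuation-slot law per background bond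
  have hpt : ∀ (u : Site (d + 1)) (κ' : Fin (d + 1)),
      (∑' z, ∑ α, vhSAt (toSite r) d L rfl κ' u ((L : ℤ) • y) z (Sum.inr μ) (Sum.inl α) * dz (fun x => ψ (blk L x)) α z)
        = (ψ (blk L (u + unitVec κ')) - ψ (y + unitVec μ)) * linKerAt (toSite r) L μ y (κ', u) := by
    intro u κ'
    rw [tsum_vhSAt_mul_dz hL hr κ' u ((L : ℤ) • y) μ (fun x => ψ (blk L x)), linSymAt_inr_inl, if_pos (off_zsmul L y), blk_zsmul hL,
      blk_zsmul_add_toSite_add y hr μ]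
  have e1 : (fun u => ∑ κ', g κ' u * (∑' z, ∑ α, vhSAt (toSite r) d L rfl κ' u ((L : ℤ) • y) z (Sum.inr μ) (Sum.inl α) * dz (fun x => ψ (blk L x)) α z))
      = fun u => ∑ κ', (fun κ' u => (ψ (blk L (u + unitVec κ')) - ψ (y + unitVec μ)) * g κ' u) κ' u * linKerAt (toSite r) L μ y (κ', u) := by
    funext u
    refine Finset.sum_congr rfl fun κ' _ => ?_
    rw [hpt u κ']; ring
  rw [e1, tsum_sum_mul_linKerAt hr]
  -- the weighted form is comb-free as well; rooted averages are straight contour sums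
  have hgw : ∀ κ u, IsCombBondAt (toSite r) L κ u → (fun κ' u => (ψ (blk L (u + unitVec κ')) - ψ (y + unitVec μ)) * g κ' u) κ u = 0 := fun κ u h => by
    show (ψ (blk L (u + unitVec κ)) - ψ (y + unitVec μ)) * g κ u = 0
    rw [hg κ u h, mul_zero]
  rw [linAvgAt_eq_contourSum_of_comb_zero hL hr hgw μ y]
  congr 1
  have esplit : (fun κ' u => (ψ (blk L (u + unitVec κ')) - ψ (y + unitVec μ)) * g κ' u)
      = (fun κ' u => ψ (blk L (u + unitVec κ')) * g κ' u) + (fun κ' u => (-ψ (y + unitVec μ)) * g κ' u) := by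
    funext κ' u; simp only [Pi.add_apply]; ring
  have hadd : ∀ (A B : Form1 (d + 1) ℝ), contourSum L (A + B) μ y = contourSum L A μ y + contourSum L B μ y := fun A B => by
    simp only [AffineAveraging.contourSum, Pi.add_apply, Finset.sum_add_distrib]
  have hsmul : ∀ (c : ℝ) (A : Form1 (d + 1) ℝ), contourSum L (fun κ' u => c * A κ' u) μ y = c * contourSum L A μ y := fun c A => by
    simp only [AffineAveraging.contourSum, Finset.mul_sum]
  rw [esplit, hadd, hsmul]
  ring

/-- NOT IN PRINT; OUR BOOKKEEPING.  **THE BORDER SECTOR LAW, DEFECT FORM**: under the same hypotheses,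
`Σ'_u Σ_κ′ g κ′ u·(Σ'_z Σ_α vhSAt ρ L κ′ u (L•y) z (inr μ)(inl α)·dz Ψ α z) = −(L^{d+1})⁻¹·(dz ψ) μ y·EI_L g μ y`, `EI_L g μ y = Σ_{b∈box} Σ_{s<L} [b_μ+s+1 < L]·g μ (L•y + b + s•e_μ)` —
the border table sees a block-constant pure gauge ONLY through the END-INSIDE partial contour sum of the background form (ENGINE E31: «V = −n^{−2D}·(C1′)»). -/
theorem border_gaugeLeg_blockConstant {L : ℕ} (hL : 1 ≤ L) {r : Fin (d + 1) → ℕ} (hr : r ∈ box (d + 1) L) {g : Form1 (d + 1) ℝ}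
    (hg : ∀ κ u, IsCombBondAt (toSite r) L κ u → g κ u = 0) (μ : Fin (d + 1)) (y : Site (d + 1)) (ψ : Site (d + 1) → ℝ) :
    ∑' u, ∑ κ', g κ' u * (∑' z, ∑ α, vhSAt (toSite r) d L rfl κ' u ((L : ℤ) • y) z (Sum.inr μ) (Sum.inl α) * dz (fun x => ψ (blk L x)) α z)
      = -(((L : ℝ) ^ (d + 1))⁻¹ * (dz ψ μ y
          * ∑ b ∈ box (d + 1) L, ∑ s ∈ Finset.range L, (if b μ + s + 1 < L then g μ ((L : ℤ) • y + toSite b + (s : ℤ) • unitVec μ) else 0))) := by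
  rw [border_gaugeLeg_blockConstant_contour hL hr hg μ y ψ, contourSum_endWeight_mul hL ψ g μ y]
  ring

/-! ## §3 The constraint-Hessian table against a block-constant pure gauge: the BASE-OUTSIDE minus END-INSIDE defect -/

/-- NOT IN PRINT; OUR BOOKKEEPING.  **THE LAGRANGE SECTOR LAW** (box root, `1 ≤ L`; `a` COMB-FREE — NO hypothesis on `𝒬_L a`; slot `(μ, w)`; coarse `ψ`, `Ψ = ψ ∘ blk L`):
`Σ'_u Σ_κ a κ u·(Σ'_x Σ_κ₂ hessFFAt ρ L μ w u x (inl κ)(inl κ₂)·dz Ψ κ₂ x) = −(2L^{d+1})⁻¹·(𝒬_L(σ_Ψ⊙a) μ w − (ψ w + ψ(w + e_μ))·𝒬_L a μ w)`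
— leaf-02's second-slot law of `h^ρ`, the commutator form of the gauge-weighted `q¹`-pairing, rooted average = contour sum on comb-free forms (FILE A's `hessFFAt_gaugeLeg_charge` with the
`𝒬_L a = 0` hypothesis REMOVED: the root weight `Ψ(L•w+ρ) + Ψ(L•w+ρ+L•e_μ) = σ_ψ(μ,w)` now survives). -/
theorem constraintHessian_gaugeLeg_blockConstant_contour {L : ℕ} (hL : 1 ≤ L) {r : Fin (d + 1) → ℕ} (hr : r ∈ box (d + 1) L) (μ : Fin (d + 1)) (w : Site (d + 1))
    {a : Form1 (d + 1) ℝ} (ha : ∀ κ u, IsCombBondAt (toSite r) L κ u → a κ u = 0) (ψ : Site (d + 1) → ℝ) :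
    ∑' u, ∑ κ, a κ u * (∑' x, ∑ κ₂, hessFFAt (toSite r) L μ w u x (Sum.inl κ) (Sum.inl κ₂) * dz (fun z => ψ (blk L z)) κ₂ x)
      = -((2 * (L : ℝ) ^ (d + 1))⁻¹ * (contourSum L (fun κ u => (ψ (blk L u) + ψ (blk L (u + unitVec κ))) * a κ u) μ w
          - (ψ w + ψ (w + unitVec μ)) * contourSum L a μ w)) := by
  have hpt : ∀ u, (∑ κ, a κ u * (∑' x, ∑ κ₂, hessFFAt (toSite r) L μ w u x (Sum.inl κ) (Sum.inl κ₂) * dz (fun z => ψ (blk L z)) κ₂ x))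
      = -(∑ κ, a κ u * (((fun z => ψ (blk L z)) u + (fun z => ψ (blk L z)) (u + unitVec κ) - (fun z => ψ (blk L z)) ((L : ℤ) • w + toSite r)
          - (fun z => ψ (blk L z)) ((L : ℤ) • w + toSite r + (L : ℤ) • unitVec μ)) * linKerAt (toSite r) L μ w (κ, u) / 2)) := by
    intro u
    rw [← Finset.sum_neg_distrib]
    refine Finset.sum_congr rfl fun κ _ => ?_
    rw [tsum_hessFFAt_mul_dz hL hr μ w u κ (fun z => ψ (blk L z))]
    ring
  rw [tsum_congr hpt, tsum_neg, tsum_sum_mul_gaugeWeight_mul_linKerAt hr (fun z => ψ (blk L z)) a μ w]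
  have hσ0 : ∀ κ u, IsCombBondAt (toSite r) L κ u → (fun κ u => ((fun z => ψ (blk L z)) u + (fun z => ψ (blk L z)) (u + unitVec κ)) * a κ u) κ u = 0 :=
    fun κ u h => by
      show (ψ (blk L u) + ψ (blk L (u + unitVec κ))) * a κ u = 0
      rw [ha κ u h, mul_zero]
  rw [linAvgAt_eq_contourSum_of_comb_zero hL hr hσ0, linAvgAt_eq_contourSum_of_comb_zero hL hr ha]
  simp only [blk_block w hr, blk_zsmul_add_toSite_add w hr μ]

/-- NOT IN PRINT; OUR BOOKKEEPING.  **THE LAGRANGE SECTOR LAW, DEFECT FORM**: under the same hypotheses,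
`Σ'_u Σ_κ a κ u·(Σ'_x Σ_κ₂ hessFFAt ρ L μ w u x (inl κ)(inl κ₂)·dz Ψ κ₂ x) = −(2L^{d+1})⁻¹·(dz ψ) μ w·(BO_L a μ w − EI_L a μ w)` — the constraint-Hessian table sees a block-constant pure
gauge ONLY through the base-outside minus end-inside partial contour sums of the other leg (ENGINE E31: «Λ = (2n^{2D})^{−1}·(C2′)»). -/
theorem constraintHessian_gaugeLeg_blockConstant {L : ℕ} (hL : 1 ≤ L) {r : Fin (d + 1) → ℕ} (hr : r ∈ box (d + 1) L) (μ : Fin (d + 1)) (w : Site (d + 1))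
    {a : Form1 (d + 1) ℝ} (ha : ∀ κ u, IsCombBondAt (toSite r) L κ u → a κ u = 0) (ψ : Site (d + 1) → ℝ) :
    ∑' u, ∑ κ, a κ u * (∑' x, ∑ κ₂, hessFFAt (toSite r) L μ w u x (Sum.inl κ) (Sum.inl κ₂) * dz (fun z => ψ (blk L z)) κ₂ x)
      = -((2 * (L : ℝ) ^ (d + 1))⁻¹ * (dz ψ μ w
          * ((∑ b ∈ box (d + 1) L, ∑ s ∈ Finset.range L, (if L ≤ b μ + s then a μ ((L : ℤ) • w + toSite b + (s : ℤ) • unitVec μ) else 0))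
            - ∑ b ∈ box (d + 1) L, ∑ s ∈ Finset.range L, (if b μ + s + 1 < L then a μ ((L : ℤ) • w + toSite b + (s : ℤ) • unitVec μ) else 0)))) := by
  rw [constraintHessian_gaugeLeg_blockConstant_contour hL hr μ w ha ψ, contourSum_bondSum_mul hL ψ a μ w]
  ring

end Summit.QuantumFields.BalabanUV.Beta.GAN24.GaugeLegDefectsBlockConstant

end
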